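import Literature.MathematicalPhysics.QuantumFieldTheory.Balaban1983to89.B6Ineq281MultiLevelBoxL0
import Literature.MathematicalPhysics.QuantumFieldTheory.Balaban1983to89.B6Cover236MultiLevelBlocksL0
import Literature.MathematicalPhysics.QuantumFieldTheory.Balaban1983to89.B6Prop23TwoLevel
import Literature.MathematicalPhysics.QuantumFieldTheory.Balaban1983to89.B6Prop22SeriesMultiLevelBoxL0
import Literature.MathematicalPhysics.QuantumFieldTheory.Balaban1983to89.B6Geom246MultiLevelBoxL0
import Literature.MathematicalPhysics.QuantumFieldTheory.Balaban1983to89.B6Ineq268MultiLevelBoxL0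
import Literature.MathematicalPhysics.QuantumFieldTheory.Balaban1983to89.B6MultiLevelBoxOperatorL0
import Literature.MathematicalPhysics.QuantumFieldTheory.Balaban1983to89.B6Prop23MultiLevelBox
/-!
# `Balaban1983to89.B6Prop23MultiLevelBoxL0` — LEVEL-0 TWIN (programme G-F3′-L0, director-ym LINE №27 / UV3-NODE §24.5; plan `lit-balaban-r03/G-F3L0-PLAN.md`) of `B6Prop23MultiLevelBox`:
the same declarations, SAME NAMES AND STATEMENTS, for nested families WITH print's region `Λ₀ = T ∖ Ω₁` ADMITTED (structures
`B6MultiLevelBoxOperatorL0.Domains` / `B6MultiLevelTorusOperatorL0.TDomains`: levels `0, …, k`, the level-`0` block a single site, `Q′₀ = id`,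
finite weight `a₀` — print p.225 (2.14) «Σ_{j=0}^k … (Q′₀λ)(x) = λ(x), x ∈ Λ₀», p.229 «taking a sequence (2.1) … smallest possible domains B^j(Λ_j),
and considering the operator Δ_a defined by (2.19), (2.20) for this sequence»).  Every `D`-free object is the lineage's, consumed BY NAME; no existing
module is touched; no fact is minted.  Unit `lit-balaban-r03` (B6 fold owner, r03 gen 36); referee ref-4.  THE TWIN'S DOCUMENTATION FOLLOWS
VERBATIM (its «levels 1 … k» / «Ω₁ = X» sentences describe the twin; here `j` runs from `0` and `Ω₁` may be a proper subset).

# `Balaban1983to89.B6Prop23MultiLevelBox` — [B6] PROPOSITION 2.3 ((2.70), (2.82)–(2.87)) FOR THE GENUINE `k`-LEVEL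
OPERATOR `G′ = Δ′_a⁻¹` ON THE NEUMANN BOX: the inverse `(Q′G′²Q′*)⁻¹ = C(I − R)⁻¹` and its kernel bound (2.87), with
EVERY located input of the cell's two-level certificate `B6Prop23TwoLevel.prop23_assembled_twoLevel` DISCHARGED on the
genuine objects (file 5 of the multi-level `(Q′G′²Q′*)⁻¹` programme; no existing module is touched; no fact is minted)

FRAMING (verbatim cell line):
statement-level skeleton of published theorems with citation tags; proofs where landed; nothing here is a claim about the Yang–Mills mass gap

Source under audit (cell pub-balaban / lit-balaban): T. Bałaban, *Propagators and renormalization transformations for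
lattice gauge theories. II*, Commun. Math. Phys. **96** (1984) 223–250 [`Balaban1984PropagatorsII`, "B6"], p. 235 [PDF 13]
((2.68)–(2.70)), p. 236 [PDF 14] ((2.71)–(2.78)), p. 237 [PDF 15] ((2.79)–(2.85)), p. 238 [PDF 16] (Proposition 2.3,
(2.86)–(2.87)) — materialised text `paper:balaban1984-cmp96-propagators-rt-ii` p0013–p0016 re-read this generation.
Unit `lit-balaban-p21` (Phase-2 proof seat p21 gen 13), HOME `run/shared/lean/pub/lit-balaban/`, B6 fold owner r03,
referee ref-4.

## WHAT IS PRINTED (p. 235, p. 238, verbatim up to notation)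

p. 235: «The approximate inverse can be constructed by taking inverses of the localized operators (Q′G′²Q′*)↾□ and
glueing them together by the decomposition of unity {h_□}. … C_□ = ((Q′G′(□̃)²Q′*)↾□)⁻¹, C = Σ_{□∈𝒟} h_□C_□h_□. (2.70)»
p. 238: «**Proposition 2.3.** An inverse of the operator Q′G′²Q′* is given by the convergent expansion
(Q′G′²Q′*)⁻¹ = C(I − R)⁻¹ = Σ_{n=0}^∞ CRⁿ = …, (2.86) and it satisfies the estimate
|(Q′G′²Q′*)⁻¹(y, y′)| ≤ O(1)(L^jη)^{−4}(L^{j′}η)^{−d}e^{−½δ₁d(y,y′)}, y, y′ ∈ 𝔅, y ∈ Λ_j, y′ ∈ Λ_{j′}. (2.87)»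

## WHAT THIS FILE CERTIFIES (kernel-checked)

For EVERY nested family `D : Domains d ℓ M_h k P R` on the fine box (levels `1 … k`, `M = L·M_h`, `R ≥ 2L`, `P_μ ≥ 1`)
and every weight sequence in the Prop. 2.2 window (`a₋ ≤ a_j ≤ a₊`, `a₋² ≤ c_j ≤ a₊²`, `a_{j+1} = aNext a_j c_j`),
with the GENUINE operator `G′ = Δ′_a⁻¹ = gml` of `B6MultiLevelBoxOperator` and the (2.69)-kernel `X` of `Q′G′²Q′*`
(`B6Ineq268MultiLevelBoxL0.Xk`): **`prop23_multiLevelBox`** — there are `δ₁, C, M₀ > 0` depending only on `d, L` and the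
weight window such that for `L·M_h ≥ M₀` («for M large enough») the operator `K_W(X) = Q′G′²Q′*` on `ℝ^𝔅` has a
UNIQUE two-sided inverse `G`, `G = C + G·R` with `C = Σ_□ h_□C_□h_□` the glued cube inverses of the FIRST printed
prescription `C_□ = ((Q′G′²Q′*)↾□)⁻¹` (`B6Ineq281MultiLevelBoxL0.CkQ` on the enlarged cubes `□⁺` of
`B6Cover236MultiLevelBlocks`) and `R` the (2.82) remainder, the kernel bound (2.87)
`|G(y, y′)| ≤ C·(L^j)^{−4}(L^{j′})^{−(d+1)}e^{−½δ₁d(y,y′)}` in the pairing (2.69), AND THE CONVERGENT EXPANSION (2.86):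
for every `N`, `G = C·Σ_{n<N}Rⁿ + G·R^N` with the remainder bound `|(G·R^N)(y, y′)| ≤ C·2^{−N}·(L^j)^{−4}(L^{j′})^{−(d+1)}
e^{−½δ₁d(y,y′)}` (the geometric tail of the sibling `B6Prop22SeriesMultiLevelBox.majorant_remainder_266W` run on the
(2.85) majorant `θe^{−δ₁d}` of `R`, `θc ≤ ½`) — uniformly in `k`, `M_h`, `R`, `P`, `D`.
The proof is the cell's `B6Prop23TwoLevel.prop23_assembled_twoLevel` (d ↦ d+1, g = `geomB D`) with its located inputs
discharged by: (2.68) `B6Ineq268MultiLevelBoxL0.ineq268_multiLevelBox` (hX, hXw; X̃_□ := X, so the change-of-domain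
family hdom is void), (2.81)/(2.70) `B6Ineq281MultiLevelBoxL0.ineq281_multiLevelBox` (h281, hCk0, h270), the cover
`B6Cover236MultiLevelBlocksL0.cover236_multiLevelBlocks` (hover, hpf01, hph, h236, hLip, hcube, hgap), Lemma 2.1 on the
box `B6Geom246MultiLevelBoxL0.lemma21_box` ((2.61) at σ = ⅛ and at rate δ₁, (2.63)), (2.60) `levelSepB`, (2.54)
`triangleB`, and the thresholds «M large» made explicit (`K285TLBox`, §1).

## HONEST SCOPE

First printed prescription `C_□ = ((Q′G′²Q′*)↾□)⁻¹` (p. 235 «taking inverses of the localized operators»), not the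
modified one with `G′(□̃)` (print: «We change this prescription a little bit»; the modification only serves print's
proof of (2.81), which `B6Ineq281MultiLevelBox` obtains for the first prescription directly from [3] Sect. 5); `□`
runs over the enlarged active big blocks `□⁺` of `B6Cover236MultiLevelBlocks` (levels `js □`, `js □ + 1`); levels
`1 … k` on a Neumann box, `m² = 0`, `R ≥ 2L`, `L ≥ 2`; all thresholds are folded into ONE condition `L·M_h ≥ M₀`
(using `R ≥ 2L ≥ 1`); the constants `δ₁, C, M₀` depend on `d, L, a_±` (print: «O(1)», L fixed).  The (2.86) SERIES
itself is the cell's `B6Prop23Chain`/`B6Prop23Assembled` Neumann series behind `prop23_assembled_twoLevel` (G = C(1−R)⁻¹,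
`G = C + G·R`); this file adds no analytic step to it.  Nothing is inferred from the manuscript: every step is
kernel-checked.
-/

namespace Literature.MathematicalPhysics.QuantumFieldTheory.Balaban1983to89.B6Prop23MultiLevelBoxL0

open Finset Matrix
open Literature.MathematicalPhysics.QuantumFieldTheory.Balaban1983to89.B4Reflection242 (boxDom)
open Literature.MathematicalPhysics.QuantumFieldTheory.Balaban1983to89.B6MultiLevelBoxOperator hiding Domains mlOp_apply
open Literature.MathematicalPhysics.QuantumFieldTheory.Balaban1983to89.B6MultiLevelBoxOperatorL0
open Literature.MathematicalPhysics.QuantumFieldTheory.Balaban1983to89.B6Geom246MultiLevelBox hiding Touch blkOf blkOf_corner blkOf_eq_iff_blk blkOf_eq_of_blk_i_eq blkOf_val bond bond_adj bset cen connected coord_bounds corner corner_mem csys dist_blkOf_le_box dist_blkOf_le_coord dist_blkOf_le_line dist_cen_le_of_adj dist_cen_le_of_touch dist_le_one_of_near dist_toR_cen_le exists_blkOf_eq geom lemma21_box lev_corner lev_eq_of_blkOf_eq levelGap pack reachable_blkOf reachable_of_near realizes scale_bounds touch_symm triangle_refl_nonneg walk_disp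
open Literature.MathematicalPhysics.QuantumFieldTheory.Balaban1983to89.B6Geom246MultiLevelBoxL0
open Literature.MathematicalPhysics.QuantumFieldTheory.Balaban1983to89.B6Ineq268MultiLevelBox hiding QB QB_apply QsB QsB_apply W W_eq W_pos Xk abs_qB abs_qB_le card_blkOf_le csysB geomB geomB_L geomB_M geomB_R geomB_RM geomB_RM_nonneg geomB_Site geomB_dist geomB_eta geomB_len geom_len ineq268_multiLevelBox instDecidableEqGeomBSite kerOp_Xk levelSepB qB qB_ne_zero realizesB refl_nonnegB sum_abs_qB_le symmB triangleB
open Literature.MathematicalPhysics.QuantumFieldTheory.Balaban1983to89.B6Ineq268MultiLevelBoxL0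
open Literature.MathematicalPhysics.QuantumFieldTheory.Balaban1983to89.B6Ineq281MultiLevelBox hiding BQ Binv Bm Bm_coercive_window Bm_entry_le Bm_form Bm_isSymm CkQ CkQ_decay CkQ_off Gm Xk_symm cw cwW_mul_le hyp56_BQ indQ ineq281_multiLevelBox invBQ_decay isPseudoDist_dist isUnit_BQ lgap loc_mul_CkQ mW mx_eq_lgap ratio_le sumBound_box sum_WXC sum_W_mul_qB wform_Xk
open Literature.MathematicalPhysics.QuantumFieldTheory.Balaban1983to89.B6Ineq281MultiLevelBoxL0
open Literature.MathematicalPhysics.QuantumFieldTheory.Balaban1983to89.B6Cover236MultiLevelBlocks hiding Down Q abs_hcov_sub_le abs_hcov_sub_le_aux abs_theta_sub_le blkOf_proj blk_wit card_filter_hcov_ne_zero_le card_filter_theta_ne_zero_le corner_add_mem cover236_multiLevelBlocks ctr cubeInd cubeInd_eq_one cubeInd_eq_zero_iff cubeInd_mul_hcov cubeInd_zero_or_one cubes disp_or_far dist_cen_ctr_own_le dist_lt_of_theta_ne_zero dist_proj_le dist_toR_ctr_le exists_wit far_exit gap_core gap_of_cubeInd_eq_zero hcov hcov_le_one hcov_nonneg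 hcube js js_le lev_wit mem_Q mem_Q_of_hcov_ne_zero mem_Q_of_theta_ne_zero near_coord nsq one_le_nsq own proj projZ side side_eq side_le_Lsq_mul_side side_pos sum_hcov_sq supNorm_proj_wit_lt theta theta_eq_one theta_le_one theta_ne_zero_of_hcov_ne_zero theta_nonneg theta_own walk_disp_or_exit window wit
open Literature.MathematicalPhysics.QuantumFieldTheory.Balaban1983to89.B6Cover236MultiLevelBlocksL0
open Literature.MathematicalPhysics.QuantumFieldTheory.Balaban1983to89.B6Ineq243TwoLevelBox (aNext)
open Literature.MathematicalPhysics.QuantumFieldTheory.Balaban1983to89.B6Expansion282 (kerOp mulOp locOp Cglued R282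
  mulOp_mul_mulOp)
open Literature.MathematicalPhysics.QuantumFieldTheory.Balaban1983to89.B6Prop23Chain (mat hasMajorant_id_iff
  kernel_bound_287 smallness_of_M_large mat_Cglued_abs_le)
open Literature.MathematicalPhysics.QuantumFieldTheory.Balaban1983to89.B6Prop23Assembled (kappa2 kappa3 abs_hf_le_one
  pf_ne_zero_of_hf_ne_zero)
open Literature.MathematicalPhysics.QuantumFieldTheory.Balaban1983to89.B6Prop23TwoLevel (kappa4TL theta285TL K285TL
  theta285TL_le mat_R_abs_le_twoLevel prop23_assembled_twoLevel)
open Literature.MathematicalPhysics.QuantumFieldTheory.Balaban1983to89.B6Prop22SeriesMultiLevelBox (partialSum_add_remainder majorant_remainder_266W)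
open Literature.MathematicalPhysics.QuantumFieldTheory.Balaban1983to89.B6RandomWalk (HasMajorant)
open Literature.MathematicalPhysics.QuantumFieldTheory.Balaban1983to89.B6Ineq261LevelGap (K261 K261_nonneg
  theta_lt_one_of_log)
open Literature.MathematicalPhysics.QuantumFieldTheory.Balaban1983to89.B6Lemma21Repaired (Ineq261With Ineq263With)
open Literature.MathematicalPhysics.QuantumFieldTheory.Balaban1983to89.B6Prop23MultiLevelBox (K285TLBox)

noncomputable section

variable {d : ℕ}

/-! ## §1 Dictionary: the threshold constant, the weight, the localisation identity (2.70) on the cover -/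

section Dictionary

variable {ℓ Mh k R : ℕ} {P : Fin (d + 1) → ℕ} (D : Domains d ℓ Mh k P R)

/-- `K285TL (geomB D) = K285TLBox` (the chain geometry has `L = ℓ + 1`). [cite: Balaban1984PropagatorsII, (2.85) p.238, dictionary] -/
theorem K285TL_geomB (dd n₀ : ℕ) (s δ₀ cσ c₃ mg BX BD BC : ℝ) :
    K285TL (B6Ineq268MultiLevelBoxL0.geomB D) dd n₀ s δ₀ cσ c₃ mg BX BD BC = K285TLBox ℓ dd n₀ s δ₀ cσ c₃ mg BX BD BC := by
  unfold K285TL kappa2 kappa3 kappa4TL K285TLBox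
  rw [geomB_L]

/-- the (2.69) weight `(L^jη)^{d+1}` of the chain geometry is `W`. [cite: Balaban1984PropagatorsII, (2.69) p.235, dictionary] -/
theorem weight_eq_W : (fun z : (B6Ineq268MultiLevelBoxL0.geomB D).Site => (geomB D).len z ^ (d + 1)) = W D := rfl

/-- the lengths of the chain geometry are those of `geom`. [cite: Balaban1984PropagatorsII, (2.1) p.224, dictionary] -/
theorem geomB_len_eq (y : ↥(B6Geom246MultiLevelBoxL0.bset D)) : (geomB D).len y = (geom D).len y := rfl

/-- the indicator of the enlarged cube is `B6Ineq281MultiLevelBoxL0.indQ` of its block set. [cite: Balaban1984PropagatorsII, (2.70) p.235, dictionary] -/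
theorem cubeInd_eq_indQ (i : ↥(B6Cover236MultiLevelBlocksL0.cubes D)) : cubeInd D i = indQ D (Q D i) := rfl

variable (a : ℕ → ℝ)

/-- **(2.70) ON THE COVER** (the binder `h270`): `□⁺X□⁺·C_□·h_□ = h_□` from `□⁺X□⁺C_□ = □⁺`
(`B6Ineq281MultiLevelBoxL0.loc_mul_CkQ`) and `□⁺h_□ = h_□`. [cite: Balaban1984PropagatorsII, (2.70) p.235, (2.82) p.237] -/
theorem h270_box (hMh : 1 ≤ Mh) (i : ↥(B6Cover236MultiLevelBlocksL0.cubes D))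
    (hloc : mulOp (indQ D (Q D i)) * kerOp (W D) (Xk D a) * mulOp (indQ D (Q D i)) * kerOp (W D) (CkQ D a (Q D i))
      = mulOp (indQ D (Q D i))) :
    locOp (fun i => mulOp (cubeInd D i)) (fun _ => kerOp (W D) (Xk D a)) i * kerOp (W D) (CkQ D a (Q D i)) *
        mulOp (hcov D i) = mulOp (hcov D i) := by
  show mulOp (cubeInd D i) * kerOp (W D) (Xk D a) * mulOp (cubeInd D i) * kerOp (W D) (CkQ D a (Q D i)) *
      mulOp (hcov D i) = mulOp (hcov D i)
  rw [cubeInd_eq_indQ, hloc, ← cubeInd_eq_indQ, mulOp_mul_mulOp]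
  exact congrArg mulOp (funext fun y => cubeInd_mul_hcov D hMh i y)

end Dictionary

/-! ## §2 Proposition 2.3 for the genuine `k`-level operator -/

set_option maxHeartbeats 400000 in
/-- **[B6] PROPOSITION 2.3 ((2.70), (2.82)–(2.87)) FOR THE GENUINE `k`-LEVEL OPERATOR ON THE NEUMANN BOX.**  There are
`δ₁, C, M₀ > 0` (depending on `d`, `L` and the weight window only) such that for every number of levels `k`, every
`M_h` with `L·M_h ≥ M₀` («for M large enough»), every `R ≥ 2L`, all box half-widths `P_μ ≥ 1`, every nested family
`D` ((2.1)–(2.2)) and all windowed weights, with `X` = the (2.69)-kernel of `Q′G′²Q′*` (`Xk`), `G′ = Δ′_a⁻¹` genuine: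
the operator `K_W(X) = Q′G′²Q′*` on `ℝ^𝔅` has a two-sided inverse `G`, UNIQUE, with **`G = C + G·R`** for the glued
cube inverses `C = Σ_□ h_□C_□h_□` (2.70) (`C_□ = ((Q′G′²Q′*)↾□⁺)⁻¹ = CkQ`, cover `B6Cover236MultiLevelBlocks`) and the
remainder `R` of (2.82), **(2.87)** `|G(y, y′)/(L^{j′})^{d+1}| ≤ C(L^j)^{−4}(L^{j′})^{−(d+1)}e^{−½δ₁d(y,y′)}` — the
cell's two-level certificate `prop23_assembled_twoLevel` with every located input discharged —, and **THE CONVERGENT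
EXPANSION (2.86)** «(Q′G′²Q′*)⁻¹ = C(I − R)⁻¹ = Σ_{n=0}^∞ CRⁿ»: `∀ N, G = C·Σ_{n<N}Rⁿ + G·R^N` with
`|(G·R^N)(y, y′)/(L^{j′})^{d+1}| ≤ C·(½)^N·(L^j)^{−4}(L^{j′})^{−(d+1)}e^{−½δ₁d(y,y′)}` (the (2.85) majorant of `R` from
`mat_R_abs_le_twoLevel`, `θc ≤ ½` by `smallness_of_M_large`, the geometric tail `majorant_remainder_266W`).
[cite: Balaban1984PropagatorsII, Prop. 2.3 (2.86)–(2.87) p.238, (2.70) p.235, (2.82)–(2.85) p.237] -/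
theorem prop23_multiLevelBox (d ℓ : ℕ) (hℓ : 1 ≤ ℓ) (aminus aplus a2minus a2plus : ℝ) (ha : 0 < aminus)
    (ha2 : 0 < a2minus) :
    ∃ δ₁ C M₀ : ℝ, 0 < δ₁ ∧ 0 < C ∧ 0 < M₀ ∧
      ∀ (k Mh R : ℕ), M₀ ≤ ((ℓ : ℝ) + 1) * Mh → 2 * (ℓ + 1) ≤ R →
      ∀ (P : Fin (d + 1) → ℕ) (_hP : ∀ μ, 1 ≤ P μ) (D : Domains d ℓ Mh k P R) (a c : ℕ → ℝ),
        (∀ i, aminus ≤ a i ∧ a i ≤ aplus) → (∀ i, a2minus ≤ c i ∧ c i ≤ a2plus) →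
        (∀ i, a (i + 1) = aNext ℓ (a i) (c i)) →
        ∃ G : Module.End ℝ (↥(bset D) → ℝ),
          G * kerOp (W D) (Xk D a) = 1 ∧ kerOp (W D) (Xk D a) * G = 1 ∧
          G = Cglued (fun i : ↥(cubes D) => mulOp (hcov D i)) (fun i => kerOp (W D) (CkQ D a (Q D i))) +
            G * R282 (kerOp (W D) (Xk D a)) (fun i : ↥(cubes D) => mulOp (cubeInd D i))
              (fun _ => kerOp (W D) (Xk D a)) (fun i => mulOp (hcov D i))
              (fun i => kerOp (W D) (CkQ D a (Q D i))) ∧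
          (∀ G' : Module.End ℝ (↥(bset D) → ℝ), G' * kerOp (W D) (Xk D a) = 1 → G' = G) ∧
          (∀ y y' : ↥(bset D), |mat G y y' / W D y'| ≤
            C * (geom D).len y ^ (-(4 : ℝ)) * (geom D).len y' ^ (-((d + 1 : ℕ) : ℝ)) *
              Real.exp (-(δ₁ / 2 * (geom D).dist y y'))) ∧
          ∀ N : ℕ,
            G = Cglued (fun i : ↥(cubes D) => mulOp (hcov D i)) (fun i => kerOp (W D) (CkQ D a (Q D i))) *
                (∑ n ∈ Finset.range N, (R282 (kerOp (W D) (Xk D a)) (fun i : ↥(cubes D) => mulOp (cubeInd D i))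
                  (fun _ => kerOp (W D) (Xk D a)) (fun i => mulOp (hcov D i))
                  (fun i => kerOp (W D) (CkQ D a (Q D i)))) ^ n) +
              G * (R282 (kerOp (W D) (Xk D a)) (fun i : ↥(cubes D) => mulOp (cubeInd D i))
                  (fun _ => kerOp (W D) (Xk D a)) (fun i => mulOp (hcov D i))
                  (fun i => kerOp (W D) (CkQ D a (Q D i)))) ^ N ∧
            ∀ y y' : ↥(bset D), |mat (G * (R282 (kerOp (W D) (Xk D a)) (fun i : ↥(cubes D) => mulOp (cubeInd D i))
                  (fun _ => kerOp (W D) (Xk D a)) (fun i => mulOp (hcov D i))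
                  (fun i => kerOp (W D) (CkQ D a (Q D i)))) ^ N) y y' / W D y'| ≤
              C * (1 / 2) ^ N * (geom D).len y ^ (-(4 : ℝ)) * (geom D).len y' ^ (-((d + 1 : ℕ) : ℝ)) *
                Real.exp (-(δ₁ / 2 * (geom D).dist y y')) := by
  obtain ⟨δ₀, CX, M₀, N₀, hδ₀, hCX, hM₀, -, h268⟩ :=
    ineq268_multiLevelBox d ℓ hℓ aminus aplus a2minus a2plus ha ha2
  obtain ⟨δ₁, BC, M₀', N₀', hδ₁, hBC, -, -, h281⟩ :=
    ineq281_multiLevelBox d ℓ hℓ aminus aplus a2minus a2plus ha ha2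
  have hL0 : (0 : ℝ) < (ℓ : ℝ) + 1 := by positivity
  have hL1 : (1 : ℝ) ≤ (ℓ : ℝ) + 1 := by linarith [(Nat.cast_nonneg ℓ : (0 : ℝ) ≤ ℓ)]
  have hlog : Real.log ((ℓ : ℝ) + 1) ≤ (ℓ : ℝ) + 1 := (Real.log_le_sub_one_of_pos hL0).trans (by linarith)
  have hlog0 : 0 ≤ Real.log ((ℓ : ℝ) + 1) := Real.log_nonneg hL1
  -- the rates: `δ_A = δ₀/2` (the rate of the weighted (2.68)), `δ₁′ = min δ₁ (δ_A/8)`, `σ = ⅛`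
  obtain ⟨δA, hδA⟩ : ∃ δA : ℝ, δA = δ₀ / 2 := ⟨_, rfl⟩
  have hδA0 : 0 < δA := by rw [hδA]; positivity
  obtain ⟨δ₁', hδ₁'⟩ : ∃ δ₁' : ℝ, δ₁' = min δ₁ (δA / 8) := ⟨_, rfl⟩
  have hδ₁'0 : 0 < δ₁' := by rw [hδ₁']; exact lt_min hδ₁ (by positivity)
  have hδ₁'le : δ₁' ≤ δ₁ := by rw [hδ₁']; exact min_le_left _ _
  have hδ₁'A : δ₁' ≤ δA / 8 := by rw [hδ₁']; exact min_le_right _ _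
  -- the (2.59)-type thresholds: Lemma 2.1 at `σ = ⅛` (rate δ_A), at `α = ½` (rate δ₁′), and `L⁴ ≤ e^{⅛δ_A(RM − 1)}`
  obtain ⟨Nσ, hNσ⟩ : ∃ Nσ : ℕ, Nσ = ⌈128 * ((d : ℝ) + 1) * ((ℓ : ℝ) + 1) / δA⌉₊ + 1 := ⟨_, rfl⟩
  have hNσpos : 0 < Nσ := by rw [hNσ]; omega
  have hNσge : 128 * ((d : ℝ) + 1) * ((ℓ : ℝ) + 1) < δA * (Nσ : ℝ) := by
    have h : 128 * ((d : ℝ) + 1) * ((ℓ : ℝ) + 1) / δA < (Nσ : ℝ) := by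
      rw [hNσ]; push_cast; exact lt_of_le_of_lt (Nat.le_ceil _) (by linarith)
    rw [div_lt_iff₀ hδA0] at h; linarith
  have hθσ : Real.exp (-(1 / 8 * δA)) * ((ℓ : ℝ) + 1) ^ ((2 * (d + 1 : ℕ) : ℝ) / Nσ) < 1 := by
    refine theta_lt_one_of_log hL0 hNσpos ?_
    push_cast
    have hd0 : (0 : ℝ) ≤ 2 * ((d : ℝ) + 1) := by positivity
    have h1 := mul_le_mul_of_nonneg_left hlog hd0
    have h2 : (0 : ℝ) ≤ ((d : ℝ) + 1) * ((ℓ : ℝ) + 1) := by positivity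
    linarith
  obtain ⟨N₁, hN₁⟩ : ∃ N₁ : ℕ, N₁ = ⌈8 * ((d : ℝ) + 1) * ((ℓ : ℝ) + 1) / δ₁'⌉₊ + 1 := ⟨_, rfl⟩
  have hN₁pos : 0 < N₁ := by rw [hN₁]; omega
  have hN₁ge : 8 * ((d : ℝ) + 1) * ((ℓ : ℝ) + 1) < δ₁' * (N₁ : ℝ) := by
    have h : 8 * ((d : ℝ) + 1) * ((ℓ : ℝ) + 1) / δ₁' < (N₁ : ℝ) := by
      rw [hN₁]; push_cast; exact lt_of_le_of_lt (Nat.le_ceil _) (by linarith)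
    rw [div_lt_iff₀ hδ₁'0] at h; linarith
  have hθ1 : Real.exp (-(1 / 2 * δ₁')) * ((ℓ : ℝ) + 1) ^ ((2 * (d + 1 : ℕ) : ℝ) / N₁) < 1 := by
    refine theta_lt_one_of_log hL0 hN₁pos ?_
    push_cast
    have hd0 : (0 : ℝ) ≤ 2 * ((d : ℝ) + 1) := by positivity
    have h1 := mul_le_mul_of_nonneg_left hlog hd0
    have h2 : (0 : ℝ) ≤ ((d : ℝ) + 1) * ((ℓ : ℝ) + 1) := by positivity
    linarith
  obtain ⟨N₂, hN₂⟩ : ∃ N₂ : ℕ, N₂ = ⌈32 * ((ℓ : ℝ) + 1) / δA⌉₊ := ⟨_, rfl⟩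
  have hN₂ge : 32 * ((ℓ : ℝ) + 1) ≤ δA * (N₂ : ℝ) := by
    have h : 32 * ((ℓ : ℝ) + 1) / δA ≤ (N₂ : ℝ) := by rw [hN₂]; exact Nat.le_ceil _
    rw [div_le_iff₀ hδA0] at h; linarith
  -- the constants
  obtain ⟨cσ, hcσ⟩ : ∃ cσ : ℝ, cσ = K261 Nσ (d + 1) ((ℓ : ℝ) + 1) 1 (1 / 8 * δA) := ⟨_, rfl⟩
  have hcσ0 : 0 ≤ cσ := by rw [hcσ]; exact K261_nonneg (by positivity) zero_le_one
  obtain ⟨cc, hcc⟩ : ∃ cc : ℝ, cc = K261 N₁ (d + 1) ((ℓ : ℝ) + 1) 1 (1 / 2 * δ₁') := ⟨_, rfl⟩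
  have hcc0 : 0 ≤ cc := by rw [hcc]; exact K261_nonneg (by positivity) zero_le_one
  obtain ⟨KM, hKM⟩ : ∃ KM : ℝ, KM = 2 * K285TLBox ℓ (d + 1) (3 * 2 ^ (d + 1)) (sLip d ℓ) δA cσ 1
      (1 / (4 * ((ℓ : ℝ) + 1))) CX 0 BC * cc := ⟨_, rfl⟩
  obtain ⟨Nmax, hNmax⟩ : ∃ Nmax : ℕ, Nmax = max N₀ (max N₀' (max Nσ (max N₁ N₂))) := ⟨_, rfl⟩
  have hN0le : N₀ ≤ Nmax := by rw [hNmax]; exact le_max_left _ _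
  have hN0'le : N₀' ≤ Nmax := by rw [hNmax]; exact (le_max_left _ _).trans (le_max_right _ _)
  have hNσle : Nσ ≤ Nmax := by
    rw [hNmax]; exact ((le_max_left _ _).trans (le_max_right _ _)).trans (le_max_right _ _)
  have hN1le : N₁ ≤ Nmax := by
    rw [hNmax]
    exact (((le_max_left _ _).trans (le_max_right _ _)).trans (le_max_right _ _)).trans (le_max_right _ _)
  have hN2le : N₂ ≤ Nmax := by
    rw [hNmax]
    exact (((le_max_right _ _).trans (le_max_right _ _)).trans (le_max_right _ _)).trans (le_max_right _ _)
  obtain ⟨M₁, hM₁⟩ : ∃ M₁ : ℝ, M₁ = max (3 * ((ℓ : ℝ) + 1)) (max M₀ (max M₀' (max KM ((Nmax : ℝ) + 1)))) :=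
    ⟨_, rfl⟩
  have h3le : 3 * ((ℓ : ℝ) + 1) ≤ M₁ := by rw [hM₁]; exact le_max_left _ _
  have hM0le : M₀ ≤ M₁ := by rw [hM₁]; exact (le_max_left _ _).trans (le_max_right _ _)
  have hM0'le : M₀' ≤ M₁ := by
    rw [hM₁]; exact ((le_max_left _ _).trans (le_max_right _ _)).trans (le_max_right _ _)
  have hKMle : KM ≤ M₁ := by
    rw [hM₁]
    exact (((le_max_left _ _).trans (le_max_right _ _)).trans (le_max_right _ _)).trans (le_max_right _ _)
  have hNmaxle : (Nmax : ℝ) + 1 ≤ M₁ := by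
    rw [hM₁]
    exact (((le_max_right _ _).trans (le_max_right _ _)).trans (le_max_right _ _)).trans (le_max_right _ _)
  have hM₁pos : 0 < M₁ := lt_of_lt_of_le (by positivity) h3le
  obtain ⟨C, hC⟩ : ∃ C : ℝ, C = 2 * (((3 * 2 ^ (d + 1) : ℕ) : ℝ) * (BC * ((ℓ : ℝ) + 1) ^ (d + 1 + 4))) * cc + 1 :=
    ⟨_, rfl⟩
  have hCpos : 0 < C := by rw [hC]; positivity
  refine ⟨δ₁', C, M₁, hδ₁'0, hCpos, hM₁pos, ?_⟩
  intro k Mh R hM hR P hP D a c haw hcw hac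
  -- the member's thresholds
  have hMh3 : 3 ≤ Mh := by
    have : (3 : ℝ) ≤ Mh := by nlinarith [h3le.trans hM]
    exact_mod_cast this
  have hMh1 : 1 ≤ Mh := le_trans (by norm_num) hMh3
  have hM0 : M₀ ≤ ((ℓ : ℝ) + 1) * Mh := hM0le.trans hM
  have hM0' : M₀' ≤ ((ℓ : ℝ) + 1) * Mh := hM0'le.trans hM
  have hKM' : KM ≤ ((ℓ : ℝ) + 1) * Mh := hKMle.trans hM
  have hR1 : 1 ≤ R := le_trans (by omega) hR
  have hRMmax : Nmax + 1 ≤ R * ((ℓ + 1) * Mh) := by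
    have h1 : ((Nmax + 1 : ℕ) : ℝ) ≤ (((ℓ + 1) * Mh : ℕ) : ℝ) := by push_cast; exact hNmaxle.trans hM
    have h2 : Nmax + 1 ≤ (ℓ + 1) * Mh := by exact_mod_cast h1
    exact h2.trans (Nat.le_mul_of_pos_left _ hR1)
  have hRM0 : N₀ + 1 ≤ R * ((ℓ + 1) * Mh) := le_trans (Nat.succ_le_succ hN0le) hRMmax
  have hRM0' : N₀' + 1 ≤ R * ((ℓ + 1) * Mh) := le_trans (Nat.succ_le_succ hN0'le) hRMmax
  have hRMσ : Nσ + 1 ≤ R * ((ℓ + 1) * Mh) := le_trans (Nat.succ_le_succ hNσle) hRMmax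
  have hRM1 : N₁ + 1 ≤ R * ((ℓ + 1) * Mh) := le_trans (Nat.succ_le_succ hN1le) hRMmax
  have hRM2 : N₂ + 1 ≤ R * ((ℓ + 1) * Mh) := le_trans (Nat.succ_le_succ hN2le) hRMmax
  have hRMone : 1 ≤ R * ((ℓ + 1) * Mh) := le_trans (by omega) hRM1
  -- the geometry `g = geomB D`
  have htri := triangleB D hMh1 hP
  obtain ⟨hrefl, hdn⟩ := refl_nonnegB D
  have hsep := levelSepB D hMh1 hP hRMone
  have hRMnn := geomB_RM_nonneg D hMh1 hRMone
  have hgL : 1 ≤ (geomB D).L := by rw [geomB_L]; exact hL1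
  have hgη : 0 < (geomB D).eta := by rw [geomB_eta]; exact one_pos
  have hgM : 0 < (geomB D).M := by rw [geomB_M]; positivity
  -- Lemma 2.1 on the box: (2.61) at `σ = ⅛` (rate δ_A), (2.61) ⟹ (2.63) at `α = ½` (rate δ₁′)
  obtain ⟨-, h261σ, -, -⟩ :=
    lemma21_box D hMh1 hP hNσpos hRMσ hδA0.le (α := 1 / 8) (by norm_num) (by norm_num) hθσ
  obtain ⟨-, h261, -, -⟩ :=
    lemma21_box D hMh1 hP hN₁pos hRM1 hδ₁'0.le (α := 1 / 2) (by norm_num) (by norm_num) hθ1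
  have h261σB : Ineq261With cσ (geomB D) δA (1 / 8) := by rw [hcσ]; exact fun z => h261σ z
  have h261B : Ineq261With cc (geomB D) δ₁' (1 / 2) := by rw [hcc]; exact fun z => h261 z
  have h263B : Ineq263With cc (geomB D) δ₁' (1 / 2) :=
    B6Lemma21Repaired.ineq263With_of_261With htri hδ₁'0.le (by norm_num) h261B
  -- the threshold `L⁴ ≤ e^{⅛δ_A(RM − 1)}`
  have hthr : (geomB D).L ^ 4 ≤ Real.exp (1 / 8 * δA * (geomB D).R * (geomB D).M) := by
    have hprod : 1 / 8 * δA * (geomB D).R * (geomB D).M = 1 / 8 * δA * ((R : ℝ) * (((ℓ : ℝ) + 1) * Mh) - 1) := by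
      rw [mul_assoc (1 / 8 * δA), geomB_RM D hMh1]
    rw [hprod, geomB_L]
    have hge : (N₂ : ℝ) ≤ (R : ℝ) * (((ℓ : ℝ) + 1) * Mh) - 1 := by
      have : ((N₂ + 1 : ℕ) : ℝ) ≤ ((R * ((ℓ + 1) * Mh) : ℕ) : ℝ) := by exact_mod_cast hRM2
      push_cast at this; linarith
    have h2 : 4 * Real.log ((ℓ : ℝ) + 1) ≤ 1 / 8 * δA * ((R : ℝ) * (((ℓ : ℝ) + 1) * Mh) - 1) := by
      have h3 := mul_le_mul_of_nonneg_left hge (by positivity : (0 : ℝ) ≤ 1 / 8 * δA)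
      linarith
    calc ((ℓ : ℝ) + 1) ^ 4 = Real.exp (4 * Real.log ((ℓ : ℝ) + 1)) := by
          rw [← Real.exp_log (pow_pos hL0 4), Real.log_pow]; norm_num
      _ ≤ _ := Real.exp_le_exp.2 h2
  -- (2.68) in the weighted form (the binders `hX`, `hXw`)
  have hX : ∀ y y'' : ↥(bset D), |(geom D).len y'' ^ (d + 1) * Xk D a y y''| ≤
      CX * (geom D).len y ^ 4 * Real.exp (-(1 / 2 * δA * (geom D).dist y y'')) := by
    intro y y''
    rw [hδA]
    exact (h268 k Mh R hMh3 hM0 hR hRM0 P hP D a c haw hcw hac y y'').2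
  -- the cover (2.36) with its seven binders
  obtain ⟨hover, hpf01, hph, h236, hLip, hcube, hgap⟩ := cover236_multiLevelBlocks D hℓ hMh1 hP hR
  -- (2.81)/(2.70) per cube
  have h281D := fun i : ↥(cubes D) =>
    h281 k Mh R hMh3 hM0' hR hRM0' P hP D a c haw hcw hac (Q D i) (js D i) (fun y hy => hcube i y
      (by rw [Ne, cubeInd_eq_zero_iff]; exact not_not.2 hy))
  have h281B : ∀ (i : ↥(cubes D)) (y y' : ↥(bset D)), cubeInd D i y ≠ 0 → cubeInd D i y' ≠ 0 →
      |CkQ D a (Q D i) y y'| ≤ BC / ((geomB D).L ^ js D i * (geomB D).eta) ^ (d + 1 + 4) *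
        Real.exp (-(δ₁' * (geom D).dist y y')) := by
    intro i y y' hy hy'
    have hyQ : y ∈ Q D i := not_not.1 fun h => hy ((cubeInd_eq_zero_iff D).2 h)
    have hy'Q : y' ∈ Q D i := not_not.1 fun h => hy' ((cubeInd_eq_zero_iff D).2 h)
    refine ((h281D i).2.2 y hyQ y' hy'Q).trans ?_
    rw [geomB_L, geomB_eta]
    refine mul_le_mul_of_nonneg_left (Real.exp_le_exp.2 ?_) (by positivity)
    have h0 := hdn y y'
    have h1 := mul_le_mul_of_nonneg_right hδ₁'le h0
    exact neg_le_neg h1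
  -- «M large enough»
  have hKMB : 2 * K285TL (geomB D) (d + 1) (3 * 2 ^ (d + 1)) (sLip d ℓ) δA cσ 1 (1 / (4 * ((ℓ : ℝ) + 1))) CX 0 BC
      * cc ≤ (geomB D).M := by
    rw [K285TL_geomB, geomB_M, ← hKM]; exact hKM'
  -- THE CELL'S TWO-LEVEL CERTIFICATE, every located input discharged
  have key := prop23_assembled_twoLevel (g := geomB D) (d + 1) htri hrefl hdn hsep
    hgL hgη hgM hRMnn (δ₀ := δA) (δ₁ := δ₁') (σ := 1 / 8) (cσ := cσ) (c := cc) (c₃ := 1) (s := sLip d ℓ)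
    (mg := 1 / (4 * ((ℓ : ℝ) + 1))) (BX := CX) (BD := 0) (BC := BC) hδA0 hδ₁'0.le (by linarith) h261σB hthr
    h261B h263B hcc0 one_pos sLip_nonneg (by positivity) hCX.le le_rfl hBC.le
    (pf := cubeInd D) (hf := hcov D) (js := js D) (n₀ := 3 * 2 ^ (d + 1)) (X := Xk D a) (Xw := fun _ => Xk D a)
    (Ck := fun i => CkQ D a (Q D i))
    hover hpf01 hph h236 hLip hcube hgap hX (fun _ => hX)
    (fun i y y'' => by rw [sub_self, mul_zero, mul_zero, zero_mul, abs_zero]; positivity)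
    h281B (fun i y'' y' hy'' => (h281D i).1 y'' y' ((cubeInd_eq_zero_iff D).1 hy''))
    (fun i => h270_box D a hMh1 i (h281D i).2.1) hKMB
  obtain ⟨G, hGX, hXG, hfix, huniq, hb⟩ := key
  -- the conversion of a bound `K·(len y⁴)⁻¹·e^{−½δ₁′d}`-type kernel estimate to the printed shape with the constant `C`
  have hleny : ∀ y : ↥(bset D), 0 < (geom D).len y := fun y => by rw [geom_len, mul_one]; positivity
  have hshape : ∀ (K : ℝ) (y y' : ↥(bset D)), K ≤ C →
      K * (geomB D).len y ^ (-(4 : ℝ)) * (geomB D).len y' ^ (-((d + 1 : ℕ) : ℝ)) *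
          Real.exp (-(δ₁' / 2 * (geomB D).dist y y')) ≤
        C * (geom D).len y ^ (-(4 : ℝ)) * (geom D).len y' ^ (-((d + 1 : ℕ) : ℝ)) *
          Real.exp (-(δ₁' / 2 * (geom D).dist y y')) := by
    intro K y y' hK
    simp only [geomB_len_eq, geomB_dist]
    have hrest : 0 ≤ (geom D).len y ^ (-(4 : ℝ)) * (geom D).len y' ^ (-((d + 1 : ℕ) : ℝ)) *
        Real.exp (-(δ₁' / 2 * (geom D).dist y y')) := by
      have := Real.rpow_nonneg (hleny y).le (-(4 : ℝ))
      have := Real.rpow_nonneg (hleny y').le (-((d + 1 : ℕ) : ℝ))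
      positivity
    calc K * (geom D).len y ^ (-(4 : ℝ)) * (geom D).len y' ^ (-((d + 1 : ℕ) : ℝ)) *
          Real.exp (-(δ₁' / 2 * (geom D).dist y y'))
        = K * ((geom D).len y ^ (-(4 : ℝ)) * (geom D).len y' ^ (-((d + 1 : ℕ) : ℝ)) *
          Real.exp (-(δ₁' / 2 * (geom D).dist y y'))) := by ring
      _ ≤ C * ((geom D).len y ^ (-(4 : ℝ)) * (geom D).len y' ^ (-((d + 1 : ℕ) : ℝ)) *
          Real.exp (-(δ₁' / 2 * (geom D).dist y y'))) := mul_le_mul_of_nonneg_right hK hrest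
      _ = _ := by ring
  have hAle : 2 * ((((3 * 2 ^ (d + 1) : ℕ)) : ℝ) * (BC * ((ℓ : ℝ) + 1) ^ (d + 1 + 4))) * cc ≤ C := by
    rw [hC]; linarith
  refine ⟨G, hGX, hXG, hfix, huniq, fun y y' => (hb y y').trans (by
    rw [geomB_L]; exact hshape _ y y' hAle), fun N => ⟨partialSum_add_remainder hfix N, fun y y' => ?_⟩⟩
  -- THE CONVERGENT EXPANSION (2.86): the remainder `G·R^N` through the sibling's geometric tail of the (2.66)-chain
  have hh1 : ∀ (i : ↥(cubes D)) (y : (geomB D).Site), |hcov D i y| ≤ 1 := abs_hf_le_one (g := geomB D) h236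
  have hdom : ∀ (i : ↥(cubes D)) (y y'' : ↥(bset D)),
      |cubeInd D i y * ((geomB D).len y'' ^ (d + 1) * (Xk D a y y'' - Xk D a y y'')) * hcov D i y''| ≤
        0 * Real.exp (-(1 * (geomB D).M)) * (geomB D).len y ^ 4 * Real.exp (-(1 / 2 * δA * (geomB D).dist y y'')) :=
    fun i y y'' => by rw [sub_self, mul_zero, mul_zero, zero_mul, abs_zero]; positivity
  have hCk0 : ∀ (i : ↥(cubes D)) (y'' y' : ↥(bset D)), cubeInd D i y'' = 0 → CkQ D a (Q D i) y'' y' = 0 :=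
    fun i y'' y' hy'' => (h281D i).1 y'' y' ((cubeInd_eq_zero_iff D).1 hy'')
  have hRb := fun y y' => mat_R_abs_le_twoLevel (g := geomB D) htri hdn hsep hgL hgη hgM hRMnn (δ₀ := δA)
    (δ₁ := δ₁') (σ := 1 / 8) (cσ := cσ) (c₃ := 1) (s := sLip d ℓ) (mg := 1 / (4 * ((ℓ : ℝ) + 1))) (BX := CX)
    (BD := 0) (BC := BC) hδA0 hδ₁'0.le (by linarith) h261σB hthr sLip_nonneg hCX.le le_rfl hBC.le (d + 1)
    (pf := cubeInd D) (hf := hcov D) (js := js D) (n₀ := 3 * 2 ^ (d + 1)) (X := Xk D a) (Xw := fun _ => Xk D a)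
    (Ck := fun i => CkQ D a (Q D i)) hover hpf01 hph hh1 hLip hcube hgap hX (fun _ => hX) hdom h281B hCk0 y y'
  have hθ0 : 0 ≤ theta285TL (geomB D) (d + 1) (3 * 2 ^ (d + 1)) (sLip d ℓ) δA cσ 1 (1 / (4 * ((ℓ : ℝ) + 1)))
      CX 0 BC := by
    have hs0 : 0 ≤ sLip d ℓ := sLip_nonneg
    unfold theta285TL kappa2 kappa3 kappa4TL; rw [geomB_L, geomB_M]; positivity
  have hθK := theta285TL_le (g := geomB D) hgM (d := d + 1) (n₀ := 3 * 2 ^ (d + 1)) (s := sLip d ℓ) hδA0 one_pos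
    (by positivity : (0 : ℝ) < 1 / (4 * ((ℓ : ℝ) + 1))) hcσ0 hCX.le (le_refl (0 : ℝ)) hBC.le
    (by rw [geomB_L]; exact hL0.le)
  obtain ⟨hhalf, hsmall, hinv2⟩ := smallness_of_M_large hgM hcc0 hθK hKMB
  have hscH : ∀ (i : ↥(cubes D)) (y : ↥(bset D)), hcov D i y ≠ 0 → (geomB D).scale y ≤ js D i + 1 :=
    fun i y h => (hcube i y (pf_ne_zero_of_hf_ne_zero (g := geomB D) (pf := cubeInd D) (hf := hcov D) hph h)).2
  have h281H : ∀ (i : ↥(cubes D)) (y y' : ↥(bset D)), hcov D i y ≠ 0 → hcov D i y' ≠ 0 →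
      |CkQ D a (Q D i) y y'| ≤ BC / ((geomB D).L ^ js D i * (geomB D).eta) ^ (d + 1 + 4) *
        Real.exp (-(δ₁' * (geom D).dist y y')) :=
    fun i y y' hy hy' => h281B i y y' (pf_ne_zero_of_hf_ne_zero (g := geomB D) (pf := cubeInd D) (hf := hcov D) hph hy) (pf_ne_zero_of_hf_ne_zero (g := geomB D) (pf := cubeInd D) (hf := hcov D) hph hy')
  have hCb := mat_Cglued_abs_le (g := geomB D) (d + 1) hgL hgη (hcov D) (fun i => CkQ D a (Q D i)) (js D) hover hh1
    hscH hBC.le h281H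
  -- the two majorants with `blk = id`
  have hA0 : (0 : ℝ) ≤ ((3 * 2 ^ (d + 1) : ℕ) : ℝ) * (BC * (geomB D).L ^ (d + 1 + 4)) := by
    rw [geomB_L]; positivity
  have hC' : HasMajorant (g := geomB D) id
      (Cglued (fun i : ↥(cubes D) => mulOp (hcov D i))
        (fun i => kerOp (fun z : (geomB D).Site => (geomB D).len z ^ (d + 1)) (CkQ D a (Q D i))))
      (fun a' b => ((3 * 2 ^ (d + 1) : ℕ) : ℝ) * (BC * (geomB D).L ^ (d + 1 + 4)) * ((geomB D).len a' ^ 4)⁻¹ *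
        Real.exp (-(δ₁' * (geomB D).dist a' b))) :=
    (hasMajorant_id_iff _ _).2 fun y y' => hCb y y'
  have hR' := (hasMajorant_id_iff (g := geomB D) _ _).2 hRb
  -- `(θc)^N(1 − θc)⁻¹ ≤ 2·(½)^N`
  have hq0 : 0 ≤ theta285TL (geomB D) (d + 1) (3 * 2 ^ (d + 1)) (sLip d ℓ) δA cσ 1 (1 / (4 * ((ℓ : ℝ) + 1)))
      CX 0 BC * cc := mul_nonneg hθ0 hcc0
  have hqN : (theta285TL (geomB D) (d + 1) (3 * 2 ^ (d + 1)) (sLip d ℓ) δA cσ 1 (1 / (4 * ((ℓ : ℝ) + 1)))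
      CX 0 BC * cc) ^ N ≤ (1 / 2) ^ N := pow_le_pow_left₀ hq0 hhalf N
  have hK : ∀ z z' : (geomB D).Site, |mat (G * (R282 (kerOp (fun w : (geomB D).Site => (geomB D).len w ^ (d + 1))
        (Xk D a)) (fun i : ↥(cubes D) => mulOp (cubeInd D i))
        (fun _ => kerOp (fun w : (geomB D).Site => (geomB D).len w ^ (d + 1)) (Xk D a)) (fun i => mulOp (hcov D i))
        (fun i => kerOp (fun w : (geomB D).Site => (geomB D).len w ^ (d + 1)) (CkQ D a (Q D i)))) ^ N) z z'| ≤
      2 * (((3 * 2 ^ (d + 1) : ℕ) : ℝ) * (BC * (geomB D).L ^ (d + 1 + 4))) * cc * (1 / 2) ^ N *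
        ((geomB D).len z ^ 4)⁻¹ * Real.exp (-((1 - 1 / 2) * δ₁' * (geomB D).dist z z')) := by
    intro z z'
    have h := (hasMajorant_id_iff (g := geomB D) _ _).1
      (majorant_remainder_266W (g := geomB D) id cc δ₁' (1 / 2)
        (theta285TL (geomB D) (d + 1) (3 * 2 ^ (d + 1)) (sLip d ℓ) δA cσ 1 (1 / (4 * ((ℓ : ℝ) + 1))) CX 0 BC)
        (((3 * 2 ^ (d + 1) : ℕ) : ℝ) * (BC * (geomB D).L ^ (d + 1 + 4)))
        (fun a' => ((geomB D).len a' ^ 4)⁻¹) hA0 (fun a' => inv_nonneg.2 (pow_nonneg (hleny a').le 4)) hθ0 hcc0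
        (by positivity) htri hrefl hdn h261B h263B hsmall hC' hR' hfix N) z z'
    refine h.trans ?_
    have hP : 0 ≤ ((geomB D).len z ^ 4)⁻¹ * Real.exp (-((1 - 1 / 2) * δ₁' * (geomB D).dist z z')) := by
      have := hleny z; positivity
    have hcoef : ((3 * 2 ^ (d + 1) : ℕ) : ℝ) * (BC * (geomB D).L ^ (d + 1 + 4)) * cc *
        (theta285TL (geomB D) (d + 1) (3 * 2 ^ (d + 1)) (sLip d ℓ) δA cσ 1 (1 / (4 * ((ℓ : ℝ) + 1))) CX 0 BC *
          cc) ^ N *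
        (1 - theta285TL (geomB D) (d + 1) (3 * 2 ^ (d + 1)) (sLip d ℓ) δA cσ 1 (1 / (4 * ((ℓ : ℝ) + 1))) CX 0 BC *
          cc)⁻¹ ≤
        2 * (((3 * 2 ^ (d + 1) : ℕ) : ℝ) * (BC * (geomB D).L ^ (d + 1 + 4))) * cc * (1 / 2) ^ N := by
      have hAc : 0 ≤ ((3 * 2 ^ (d + 1) : ℕ) : ℝ) * (BC * (geomB D).L ^ (d + 1 + 4)) * cc := mul_nonneg hA0 hcc0
      have hinv0 : 0 ≤ (1 - theta285TL (geomB D) (d + 1) (3 * 2 ^ (d + 1)) (sLip d ℓ) δA cσ 1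
          (1 / (4 * ((ℓ : ℝ) + 1))) CX 0 BC * cc)⁻¹ := inv_nonneg.2 (by linarith)
      calc _ ≤ ((3 * 2 ^ (d + 1) : ℕ) : ℝ) * (BC * (geomB D).L ^ (d + 1 + 4)) * cc * (1 / 2) ^ N * 2 := by
            apply mul_le_mul _ hinv2 hinv0 (by positivity)
            exact mul_le_mul_of_nonneg_left hqN hAc
        _ = _ := by ring
    calc _ = ((3 * 2 ^ (d + 1) : ℕ) : ℝ) * (BC * (geomB D).L ^ (d + 1 + 4)) * cc *
          (theta285TL (geomB D) (d + 1) (3 * 2 ^ (d + 1)) (sLip d ℓ) δA cσ 1 (1 / (4 * ((ℓ : ℝ) + 1))) CX 0 BC *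
            cc) ^ N *
          (1 - theta285TL (geomB D) (d + 1) (3 * 2 ^ (d + 1)) (sLip d ℓ) δA cσ 1 (1 / (4 * ((ℓ : ℝ) + 1))) CX 0 BC *
            cc)⁻¹ * (((geomB D).len z ^ 4)⁻¹ * Real.exp (-((1 - 1 / 2) * δ₁' * (geomB D).dist z z'))) := by ring
      _ ≤ 2 * (((3 * 2 ^ (d + 1) : ℕ) : ℝ) * (BC * (geomB D).L ^ (d + 1 + 4))) * cc * (1 / 2) ^ N *
          (((geomB D).len z ^ 4)⁻¹ * Real.exp (-((1 - 1 / 2) * δ₁' * (geomB D).dist z z'))) :=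
          mul_le_mul_of_nonneg_right hcoef hP
      _ = _ := by ring
  have hgL0 : 0 < (geomB D).L := by rw [geomB_L]; exact hL0
  refine (kernel_bound_287 (g := geomB D) (d + 1) hgL0 hgη hK y y').trans ?_
  have hKC : 2 * (((3 * 2 ^ (d + 1) : ℕ) : ℝ) * (BC * (geomB D).L ^ (d + 1 + 4))) * cc * (1 / 2) ^ N ≤
      C * (1 / 2) ^ N := by
    rw [geomB_L]; exact mul_le_mul_of_nonneg_right hAle (by positivity)
  -- direct comparison
  simp only [geomB_len_eq, geomB_dist] at hKC ⊢
  have hrest : 0 ≤ (geom D).len y ^ (-(4 : ℝ)) * (geom D).len y' ^ (-((d + 1 : ℕ) : ℝ)) *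
      Real.exp (-(δ₁' / 2 * (geom D).dist y y')) := by
    have := Real.rpow_nonneg (hleny y).le (-(4 : ℝ))
    have := Real.rpow_nonneg (hleny y').le (-((d + 1 : ℕ) : ℝ))
    positivity
  calc 2 * (((3 * 2 ^ (d + 1) : ℕ) : ℝ) * (BC * (geomB D).L ^ (d + 1 + 4))) * cc * (1 / 2) ^ N *
        (geom D).len y ^ (-(4 : ℝ)) * (geom D).len y' ^ (-((d + 1 : ℕ) : ℝ)) *
        Real.exp (-(δ₁' / 2 * (geom D).dist y y'))
      = 2 * (((3 * 2 ^ (d + 1) : ℕ) : ℝ) * (BC * (geomB D).L ^ (d + 1 + 4))) * cc * (1 / 2) ^ N *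
        ((geom D).len y ^ (-(4 : ℝ)) * (geom D).len y' ^ (-((d + 1 : ℕ) : ℝ)) *
        Real.exp (-(δ₁' / 2 * (geom D).dist y y'))) := by ring
    _ ≤ C * (1 / 2) ^ N * ((geom D).len y ^ (-(4 : ℝ)) * (geom D).len y' ^ (-((d + 1 : ℕ) : ℝ)) *
        Real.exp (-(δ₁' / 2 * (geom D).dist y y'))) := mul_le_mul_of_nonneg_right hKC hrest
    _ = _ := by ring

end

end Literature.MathematicalPhysics.QuantumFieldTheory.Balaban1983to89.B6Prop23MultiLevelBoxL0
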